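import Summits.MatrixMultiplication.MatrixMultiplication.Theorems.OutsiderSandwichFlandersCounts
import HarnessLib

/-!
# Flanders' theorem, and the exact rate `3m ≤ 2B` at every level

Route `OutsiderSandwich` (decomposition cell `decomp-mm`, lens 4 «minimal counterexample /
extremal reduction», gen 28, addendum), support for the aside leaf `BlockOneIsMM`
(stmt-MatrixMultiplication-27147).  The top rung of the rate ladder: a determinant-free,
kernel-checked proof of

**Flanders' theorem** (`flanders`): a linear subspace `P ≤ M_n(ℂ)` all of whose elements have
rank `≤ r` has `dim P ≤ r·n`.

Proof.  Let `X₀ ∈ P` have maximal rank `r₀ ≤ r`; split `V = K ⊕ U` (`K = ker X₀`) and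
`V = I ⊕ I'` (`I = im X₀`).  Every `X ∈ P` maps `K` into `I` (first-order condition,
`OutsiderSandwichFirstOrder`).  Let `W₀ = {X ∈ P : X U ⊆ I'}` and
`W₀₀ = {X ∈ W₀ : X K = 0}`, and let `S ≤ I` be the span of `X K` over `X ∈ W₀`, `s = dim S`.
Count A gives `dim P ≤ dim W₀ + r₀²`; count B gives `dim W₀ ≤ dim W₀₀ + (n − r₀)s`; the
polarised second-order condition (`OutsiderSandwichFlandersCounts.second_order_polar`) shows
that every `X ∈ W₀₀` kills `K ⊕ X₀|_U⁻¹(S)`, a space of dimension `≥ (n − r₀) + s`, and maps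
`V` into `I'`, so count C gives `dim W₀₀ ≤ (r₀ − s)(n − r₀)`.  Summing,
`dim P ≤ r₀² + (n − r₀)s + (r₀ − s)(n − r₀) = r₀ n`.

Consequences (discharging the hypothesis `hF` of `OutsiderSandwichGenericRank`):
* `pairRank_le_sq` — the **full core bound `n²`** for spaces of pairs with `V·Y = 0`;
* `rate_law₅` — **`Amortised N B m ⟹ 3m ≤ 2B` for every `N ≥ 1`**, unconditionally: the
  exact level-one law `a(1,m) = ⌈3m/2⌉` (`OutsiderSandwichLevelOne`) persists as the lower bound
  `a(N,m) ≥ ⌈3m/2⌉` at every level (`rate_amortisedNumber₅`); e.g. `a(2,3) ≥ 5`, `a(3,4) ≥ 6`,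
  `¬Amortised 2 4 3`.  This is the ceiling of the core-bound method (`level_law` with `c = n²`).

## References
* P. Bürgisser, M. Clausen, M. A. Shokrollahi, *Algebraic Complexity Theory*, Springer (1997),
  §17.1. [BurgisserClausenShokrollahi1997]
* D. Coppersmith, S. Winograd, *Matrix multiplication via arithmetic progressions*,
  J. Symbolic Comput. 9 (1990) 251–280, §7. [CoppersmithWinograd1990]
-/

noncomputable section
open scoped BigOperators Matrix
set_option linter.dupNamespace false
set_option autoImplicit false

namespace Summit.MatrixMultiplication.MatrixMultiplication.Theorems.OutsiderSandwichFlanders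

open Literature.Computability.AlgebraicComplexity
open Summit.MatrixMultiplication.MatrixMultiplication.Theorems.OutsiderSandwichAmortised
open Summit.MatrixMultiplication.MatrixMultiplication.Theorems.OutsiderSandwichAmortisedTable
open Summit.MatrixMultiplication.MatrixMultiplication.Theorems.OutsiderSandwichLevelLaw
open Summit.MatrixMultiplication.MatrixMultiplication.Theorems.OutsiderSandwichGenericRank
open Summit.MatrixMultiplication.MatrixMultiplication.Theorems.OutsiderSandwichFirstOrder
open Summit.MatrixMultiplication.MatrixMultiplication.Theorems.OutsiderSandwichFlandersCounts

/-! ## 1. Flanders' theorem -/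

section Flanders

variable {ρ : Type} [Fintype ρ] [DecidableEq ρ]

omit [DecidableEq ρ] in
/-- The key step: an `X ∈ P` with `X U ⊆ I'` and `X K = 0` kills every `u ∈ U` with `X₀ u` in
the span `S` of `X' K`, `X' ∈ P` with `X' U ⊆ I'`. [cite: BurgisserClausenShokrollahi1997, §17.1] -/
theorem mulVec_eq_zero_of_mem_span (P : Submodule ℂ (Matrix ρ ρ ℂ)) {X₀ : Matrix ρ ρ ℂ}
    (hX₀ : X₀ ∈ P) (hmax : ∀ X ∈ P, X.rank ≤ X₀.rank) {U I' : Submodule ℂ (ρ → ℂ)}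
    (hU : IsCompl (LinearMap.ker X₀.mulVecLin) U)
    (hI : IsCompl (LinearMap.range X₀.mulVecLin) I')
    {X : Matrix ρ ρ ℂ} (hX : X ∈ P) (hW : ∀ u ∈ U, X *ᵥ u ∈ I')
    (hK : ∀ k, X₀ *ᵥ k = 0 → X *ᵥ k = 0) {u : ρ → ℂ} (hu : u ∈ U)
    (hS : X₀ *ᵥ u ∈ Submodule.span ℂ {v : ρ → ℂ | ∃ X' ∈ P, (∀ u ∈ U, X' *ᵥ u ∈ I') ∧
      ∃ k : ρ → ℂ, X₀ *ᵥ k = 0 ∧ v = X' *ᵥ k}) :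
    X *ᵥ u = 0 := by
  -- `Q v`: some `u' ∈ U` with `X₀ u' = v` is killed by `X`
  have key : ∀ v ∈ Submodule.span ℂ {v : ρ → ℂ | ∃ X' ∈ P, (∀ u ∈ U, X' *ᵥ u ∈ I') ∧
      ∃ k : ρ → ℂ, X₀ *ᵥ k = 0 ∧ v = X' *ᵥ k},
      ∃ u' ∈ U, X₀ *ᵥ u' = v ∧ X *ᵥ u' = 0 := by
    intro v hv
    induction hv using Submodule.span_induction with
    | mem v hv =>
      obtain ⟨X', hX', hW', k, hk, rfl⟩ := hv
      have hkI := mulVec_mem_range_of_max P hX₀ hmax hX' hk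
      obtain ⟨w, hw⟩ := hkI
      have hwt : w ∈ LinearMap.ker X₀.mulVecLin ⊔ U := by
        rw [hU.sup_eq_top]; exact Submodule.mem_top
      obtain ⟨k', hk', u', hu', rfl⟩ := Submodule.mem_sup.1 hwt
      have hu'k : X₀ *ᵥ u' = X' *ᵥ k := by
        rw [← hw, Matrix.mulVecLin_apply, Matrix.mulVec_add,
          show X₀ *ᵥ k' = 0 from LinearMap.mem_ker.1 hk', zero_add]
      refine ⟨u', hu', hu'k, ?_⟩
      have h := second_order_polar P hX₀ hmax hU hI hX hX' hW hW' hk U.zero_mem hu'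
        (by rw [Matrix.mulVec_zero, hK k hk]) hu'k
      rwa [Matrix.mulVec_zero, zero_add] at h
    | zero => exact ⟨0, U.zero_mem, by rw [Matrix.mulVec_zero], by rw [Matrix.mulVec_zero]⟩
    | add v w _ _ hv hw =>
      obtain ⟨u₁, hu₁, h₁, h₁'⟩ := hv
      obtain ⟨u₂, hu₂, h₂, h₂'⟩ := hw
      exact ⟨u₁ + u₂, U.add_mem hu₁ hu₂, by rw [Matrix.mulVec_add, h₁, h₂],
        by rw [Matrix.mulVec_add, h₁', h₂', add_zero]⟩
    | smul c v _ hv =>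
      obtain ⟨u₁, hu₁, h₁, h₁'⟩ := hv
      exact ⟨c • u₁, U.smul_mem c hu₁, by rw [Matrix.mulVec_smul, h₁],
        by rw [Matrix.mulVec_smul, h₁', smul_zero]⟩
  obtain ⟨u', hu', h0, hX0⟩ := key _ hS
  have hmem : u' - u ∈ LinearMap.ker X₀.mulVecLin ⊓ U := Submodule.mem_inf.2
    ⟨by rw [LinearMap.mem_ker, Matrix.mulVecLin_apply, Matrix.mulVec_sub, h0, sub_self],
      U.sub_mem hu' hu⟩
  rw [hU.inf_eq_bot, Submodule.mem_bot, sub_eq_zero] at hmem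
  rw [← hmem, hX0]

/-- **Flanders' theorem.**  A linear subspace of `M_n(ℂ)` all of whose elements have rank `≤ r`
has dimension `≤ r·n`. [cite: BurgisserClausenShokrollahi1997, §17.1] -/
theorem flanders (r : ℕ) (P : Submodule ℂ (Matrix ρ ρ ℂ)) (hP : ∀ X ∈ P, X.rank ≤ r) :
    Module.finrank ℂ P ≤ r * Fintype.card ρ := by
  classical
  obtain ⟨X₀, hX₀, hmax⟩ := exists_max_rank (P : Set (Matrix ρ ρ ℂ)) ⟨0, P.zero_mem⟩
  replace hmax : ∀ X ∈ P, X.rank ≤ X₀.rank := fun X hX => hmax X hX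
  refine le_trans ?_ (Nat.mul_le_mul_right _ (hP X₀ hX₀))
  obtain ⟨U, hU⟩ := Submodule.exists_isCompl (LinearMap.ker X₀.mulVecLin)
  obtain ⟨I', hI⟩ := Submodule.exists_isCompl (LinearMap.range X₀.mulVecLin)
  -- the two filtrations steps `W₀ ⊇ W₀₀` of `P`
  let W₀ : Submodule ℂ (Matrix ρ ρ ℂ) :=
    { carrier := {X | X ∈ P ∧ ∀ u ∈ U, X *ᵥ u ∈ I'}
      add_mem' := fun {X Y} hX hY => ⟨P.add_mem hX.1 hY.1, fun u hu => by
        rw [Matrix.add_mulVec]; exact I'.add_mem (hX.2 u hu) (hY.2 u hu)⟩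
      zero_mem' := ⟨P.zero_mem, fun u _ => by rw [Matrix.zero_mulVec]; exact I'.zero_mem⟩
      smul_mem' := fun c {X} hX => ⟨P.smul_mem c hX.1, fun u hu => by
        rw [Matrix.smul_mulVec]; exact I'.smul_mem c (hX.2 u hu)⟩ }
  have memW₀ : ∀ X, X ∈ W₀ ↔ X ∈ P ∧ ∀ u ∈ U, X *ᵥ u ∈ I' := fun X => Iff.rfl
  let W₀₀ : Submodule ℂ (Matrix ρ ρ ℂ) :=
    { carrier := {X | X ∈ W₀ ∧ ∀ k, X₀ *ᵥ k = 0 → X *ᵥ k = 0}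
      add_mem' := fun {X Y} hX hY => ⟨W₀.add_mem hX.1 hY.1, fun k hk => by
        rw [Matrix.add_mulVec, hX.2 k hk, hY.2 k hk, add_zero]⟩
      zero_mem' := ⟨W₀.zero_mem, fun k _ => by rw [Matrix.zero_mulVec]⟩
      smul_mem' := fun c {X} hX => ⟨W₀.smul_mem c hX.1, fun k hk => by
        rw [Matrix.smul_mulVec, hX.2 k hk, smul_zero]⟩ }
  have memW₀₀ : ∀ X, X ∈ W₀₀ ↔ X ∈ W₀ ∧ ∀ k, X₀ *ᵥ k = 0 → X *ᵥ k = 0 := fun X => Iff.rfl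
  -- the span `S` of `X K`, `X ∈ W₀`, and `U₁ = U ∩ X₀⁻¹ S`
  let S : Submodule ℂ (ρ → ℂ) := Submodule.span ℂ {v : ρ → ℂ | ∃ X' ∈ P,
    (∀ u ∈ U, X' *ᵥ u ∈ I') ∧ ∃ k : ρ → ℂ, X₀ *ᵥ k = 0 ∧ v = X' *ᵥ k}
  let U₁ : Submodule ℂ (ρ → ℂ) := U ⊓ S.comap X₀.mulVecLin
  have hSI : S ≤ LinearMap.range X₀.mulVecLin := by
    refine Submodule.span_le.2 ?_
    rintro _ ⟨X', hX', -, k, hk, rfl⟩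
    exact mulVec_mem_range_of_max P hX₀ hmax hX' hk
  -- count A
  have h1 := finrank_le_count_quot P W₀ U I' fun X hX h => ⟨hX, h⟩
  -- count B
  have h2 := finrank_le_count_val W₀ W₀₀ (LinearMap.ker X₀.mulVecLin) S
    (fun X hX k hk => Submodule.subset_span ⟨X, hX.1, hX.2, k, LinearMap.mem_ker.1 hk, rfl⟩)
    (fun X hX h => ⟨hX, fun k hk => h k (LinearMap.mem_ker.2 hk)⟩)
  -- count C
  have h3 := finrank_le_count_zero W₀₀ (LinearMap.ker X₀.mulVecLin ⊔ U₁) I'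
    (fun X hX a ha => by
      obtain ⟨k, hk, u, hu, rfl⟩ := Submodule.mem_sup.1 ha
      rw [Matrix.mulVec_add, hX.2 k (LinearMap.mem_ker.1 hk), zero_add]
      exact mulVec_eq_zero_of_mem_span P hX₀ hmax hU hI hX.1.1 hX.1.2 hX.2 hu.1 hu.2)
    (fun X hX v => by
      have hv : v ∈ LinearMap.ker X₀.mulVecLin ⊔ U := by
        rw [hU.sup_eq_top]; exact Submodule.mem_top
      obtain ⟨k, hk, u, hu, rfl⟩ := Submodule.mem_sup.1 hv
      rw [Matrix.mulVec_add, hX.2 k (LinearMap.mem_ker.1 hk), zero_add]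
      exact hX.1.2 u hu)
  -- dimensions
  have hK := LinearMap.finrank_range_add_finrank_ker X₀.mulVecLin
  have hU' := Submodule.finrank_add_eq_of_isCompl hU
  have hI'' := Submodule.finrank_add_eq_of_isCompl hI
  rw [Module.finrank_fintype_fun_eq_card] at hK hU' hI''
  have hr : Module.finrank ℂ (LinearMap.range X₀.mulVecLin) = X₀.rank := rfl
  have hs : Module.finrank ℂ S ≤ X₀.rank := hr ▸ Submodule.finrank_mono hSI
  -- `dim (K ⊔ U₁) ≥ (n − r₀) + s`
  have hdisj : LinearMap.ker X₀.mulVecLin ⊓ U₁ = ⊥ :=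
    eq_bot_iff.2 fun v hv => by rw [← hU.inf_eq_bot]; exact ⟨hv.1, hv.2.1⟩
  have hsup := Submodule.finrank_sup_add_finrank_inf_eq (LinearMap.ker X₀.mulVecLin) U₁
  rw [hdisj, finrank_bot, add_zero] at hsup
  have hSU : S ≤ U₁.map X₀.mulVecLin := by
    intro y hy
    obtain ⟨w, hw⟩ := hSI hy
    have hwt : w ∈ LinearMap.ker X₀.mulVecLin ⊔ U := by
      rw [hU.sup_eq_top]; exact Submodule.mem_top
    obtain ⟨k, hk, u, hu, rfl⟩ := Submodule.mem_sup.1 hwt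
    have hyu : X₀.mulVecLin u = y := by
      rw [← hw, map_add, LinearMap.mem_ker.1 hk, zero_add]
    refine ⟨u, ⟨hu, ?_⟩, hyu⟩
    show X₀.mulVecLin u ∈ S
    rw [hyu]; exact hy
  have hU₁ : Module.finrank ℂ S ≤ Module.finrank ℂ U₁ :=
    (Submodule.finrank_mono hSU).trans (Submodule.finrank_map_le _ _)
  -- assemble
  obtain ⟨e, he⟩ : ∃ e, Fintype.card ρ = X₀.rank + e := ⟨Fintype.card ρ - X₀.rank, by omega⟩
  obtain ⟨d, hd⟩ : ∃ d, X₀.rank = Module.finrank ℂ S + d := ⟨X₀.rank - Module.finrank ℂ S, by omega⟩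
  rw [show Fintype.card ρ - Module.finrank ℂ I' = X₀.rank by omega,
    show Module.finrank ℂ U = X₀.rank by omega] at h1
  rw [show Module.finrank ℂ (LinearMap.ker X₀.mulVecLin) = e by omega] at h2
  have h3' : Module.finrank ℂ W₀₀ ≤ d * e :=
    h3.trans (Nat.mul_le_mul (by omega) (by omega))
  calc Module.finrank ℂ P ≤ X₀.rank * X₀.rank + e * Module.finrank ℂ S + d * e := by omega
    _ = X₀.rank * Fintype.card ρ := by rw [he, hd]; ring

/-- Flanders' theorem in the hypothesis shape of `OutsiderSandwichGenericRank`. [folklore] -/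
theorem flanders_hF : ∀ (r : ℕ) (P : Submodule ℂ (Matrix ρ ρ ℂ)), (∀ X ∈ P, X.rank ≤ r) →
    Module.finrank ℂ P ≤ r * Fintype.card ρ := fun r P hP => flanders r P hP

/-- **Full core bound `n²`**, now unconditional: a space `L` of pairs of `n × n` matrices with
`V·Y = 0` on `L` has `dim π₁L + dim π₂L ≤ n²`. [cite: BurgisserClausenShokrollahi1997, §17.1] -/
theorem pairRank_le_sq (L : Submodule ℂ (Matrix ρ ρ ℂ × Matrix ρ ρ ℂ))
    (hL : ∀ x ∈ L, x.1 * x.2 = 0) : pairRank ρ L ≤ Fintype.card ρ ^ 2 :=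
  pairRank_le_sq_of_flanders flanders_hF L hL

end Flanders

/-! ## 2. The exact rate at every level -/

/-- **Rate law, top rung**: `Amortised N B m ⟹ 3m ≤ 2B` for every `N ≥ 1` — the level-one
law persists at all levels. [cite: CoppersmithWinograd1990, §7] -/
theorem rate_law₅ {N B m : ℕ} (hN : 1 ≤ N) (h : Amortised N B m) : 3 * m ≤ 2 * B :=
  rate_law_of_flanders hN flanders_hF h

/-- **`3m ≤ 2·a(N, m)` for every `N ≥ 1`**, i.e. `a(N, m) ≥ ⌈3m/2⌉ = a(1, m)`.
[cite: CoppersmithWinograd1990, §7] -/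
theorem rate_amortisedNumber₅ {N : ℕ} (hN : 1 ≤ N) (m : ℕ) :
    3 * m ≤ 2 * amortisedNumber N m :=
  amortisedNumber_of_flanders hN flanders_hF m

/-- `2B < 3m ⟹ ⟨B⟩ ⊠ C₁^{⊠N} ⋭ ⟨m⟩ ⊠ ⟨2,2,2⟩^{⊠N}` (`N ≥ 1`). [cite: CoppersmithWinograd1990, §7] -/
theorem not_amortised_of_lt₅ {N B m : ℕ} (hN : 1 ≤ N) (hlt : 2 * B < 3 * m) :
    ¬ Amortised N B m := fun h => by
  have e := rate_law₅ hN h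
  omega

/-- Level two: **`a(2,3) ≥ 5`**. [cite: CoppersmithWinograd1990, §7] -/
theorem amortisedNumber_two_three : 5 ≤ amortisedNumber 2 3 := by
  have h := rate_amortisedNumber₅ (by norm_num : 1 ≤ 2) 3
  omega

/-- Level two: `⟨4⟩ ⊠ C₁^{⊠2} ⋭ ⟨3⟩ ⊠ ⟨2,2,2⟩^{⊠2}`. [cite: CoppersmithWinograd1990, §7] -/
theorem not_amortised_two_4_3 : ¬ Amortised 2 4 3 :=
  not_amortised_of_lt₅ (by norm_num) (by norm_num)

/-- Level three: **`a(3,4) ≥ 6`**. [cite: CoppersmithWinograd1990, §7] -/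
theorem amortisedNumber_three_four : 6 ≤ amortisedNumber 3 4 := by
  have h := rate_amortisedNumber₅ (by norm_num : 1 ≤ 3) 4
  omega

end Summit.MatrixMultiplication.MatrixMultiplication.Theorems.OutsiderSandwichFlanders
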